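/-
Copyright: the b2b-balaban T⁴-continuum CRUX team, row NE7b OWNER lineage `t4-ne7b-p1` (gen 142). Project licence.
-/
import Summits.QuantumFields.BalabanUV.T4Continuum.Spine.NE7b.SupFifthCumulantSingleCuts45
import Summits.QuantumFields.BalabanUV.T4Continuum.Spine.NE7b.SupFifthCumulantPairCutsA
import Summits.QuantumFields.BalabanUV.T4Continuum.Spine.NE7b.SupFifthCumulantPairCutsB
import Summits.QuantumFields.BalabanUV.T4Continuum.Spine.NE7b.SupFifthCumulantPairCutsC
import Summits.QuantumFields.BalabanUV.T4Continuum.Spine.NE7b.SupFifthCumulantPairCutsD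
import Summits.QuantumFields.BalabanUV.T4Continuum.Spine.NE7b.SupFifthCumulantPairCutsE
import Summits.QuantumFields.BalabanUV.T4Continuum.Spine.NE7b.SupFivePointMinMax

/-!
# THE FIFTH CUMULANT HAS THRESHOLD (HENCE TREE) DECAY (SCOPING (d14)(2)(ii) — THE END of the abstract cut block; the order-5 analogue of (496)).
# The fifteen cut bounds (546)∕(547)∕(550)–(556) — `|u₅| ≤ C₁∕r_min⁶` for the five single cuts, `|u₅| ≤ C₂∕r_min⁶` for the ten pair–triple cuts —
# are exactly the fifteen hypotheses of (539) `five_point_cut_minmax` with the weights `q_e := r_e⁻¹` (`r_min⁻⁶ ≤ r_min⁻⁴ ≤ (max crossing q)⁴` as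
# `r ≥ 1`), whence
#   `|u₅| ≤ (C₁ + C₂)·t⋆⁴`,   `t⋆ = min_S max_{e crossing S} r_e⁻¹`  ((539)'s min–max threshold, WRITTEN OUT),
#   `C₁ = 4K + 5M₆ + M₂M₄ + 2K(M₂+M₄) + 24M₂√(KM₄)`,  `C₂ = 6K + 5M₆ + (M₂+M₄)²∕2 + 3M₂M₄ + 3K(M₂+M₄) + 12M₂√(KM₄)`
# — THRESHOLD DECAY OF THE FIFTH CUMULANT under Dobrushin's condition, every constant explicit, SIXTH MOMENTS ONLY; with (539) `minmax_pow4_le_greedy_r`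
# and (538) its five fixed-slot site sums are volume-uniform (`≤ 576·(C₁+C₂)·S′⁴`).  The whitened instantiation (`F_v = U′(Aξ+ψ)[e_v]`, (466), (505))
# is the successor's next file (row NE7b, node U5c; (539), (546), (547), (550)–(556) BY NAME; [folklore])

Cell `pub-balaban`, sub-cell `t4`, spine estimate NE7b (`T4WeightBudget.RelWeightBound`; the cell's OWN estimate — NOT PRINTED in
[Bałaban 1983–89], NOT PROVED).  Crux-route work under `Spine/NE7b/` by the row OWNER (`t4-ne7b-p1` gen 142, file (557)) under FREEZE
(0)'s crux-prover clause; NOTHING of Bałaban's is named as a Lean object, valued or asserted; no `T4Continuum/Support` leaf typed; no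
`def`, no notation (`u₅` and `t⋆` WRITTEN OUT); zero `sorry`.  Imports (BY NAME): the OWNER's (551)–(556) and (539).

WHAT IS PROVED ([folklore]): §1 `cut_to_threshold4`, `cut_to_threshold6`; §2 THE END **`fifth_cumulant_threshold_bound`**.

HONEST (what this is NOT).  The abstract Gibbs-format statement; the whitened instantiation, the row∕slot letters via (538)∕(539), the order-5
entries, the FORM of `∂⁵W` and its letters are the successor's; scalar skeleton ((A3), NC-NE7b-α UNRULED); nothing of Bałaban's asserted.  BY-NAME
EFFECT ON THE WALL: NONE.  NE7b NOT PRINTED ∕ NOT PROVED; spine PROVED 0∕9; rung (B)+1 — FINITE-torus statements; NOT the mass gap, NOT Clay.  HONEST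
DEPENDENCY: continuum YM on T⁴ ⇐ BetaPertH ∧ nine spine estimates (0∕9 proved); BetaPertH ⇐ (D1) ∧ (D4) ∧ CAP+tail; G-an2-4 gates asym, D1 and
NE2∕3∕4.
-/

set_option autoImplicit false

noncomputable section

namespace Summit.QuantumFields.BalabanUV.T4Continuum.NE7b.SupFifthCumulantThreshold

open MeasureTheory Real Set Function Finset
open scoped BigOperators
open SupFifthCumulantSingleCuts (fifth_cumulant_single_cut)
open SupFifthCumulantPairCuts (fifth_cumulant_pair_cut)
open SupFifthCumulantSingleCuts23 (fifth_cumulant_single_cut_2 fifth_cumulant_single_cut_3)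
open SupFifthCumulantSingleCuts45 (fifth_cumulant_single_cut_4 fifth_cumulant_single_cut_5)
open SupFifthCumulantPairCutsA (fifth_cumulant_pair_cut_13 fifth_cumulant_pair_cut_14)
open SupFifthCumulantPairCutsB (fifth_cumulant_pair_cut_15 fifth_cumulant_pair_cut_23)
open SupFifthCumulantPairCutsC (fifth_cumulant_pair_cut_24 fifth_cumulant_pair_cut_25)
open SupFifthCumulantPairCutsD (fifth_cumulant_pair_cut_34 fifth_cumulant_pair_cut_35)
open SupFifthCumulantPairCutsE (fifth_cumulant_pair_cut_45)
open SupFivePointMinMax (five_point_cut_minmax)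

/-! ## §1. From `C′∕r_min⁶` to `C·(max r⁻¹)⁴` -/

/-- Four crossing weights: `|u| ≤ C′∕min(a,b,c,d)⁶`, `C′ ≤ C`, `a,b,c,d ≥ 1`, each `·⁻¹ ≤ M` give `|u| ≤ C·M⁴`. [folklore] -/
theorem cut_to_threshold4 {u C' C a b c d M : ℝ} (h : |u| ≤ C' / (min a (min b (min c d))) ^ 6) (hC : C' ≤ C) (hC' : 0 ≤ C') (ha : 1 ≤ a)
    (hb : 1 ≤ b) (hc : 1 ≤ c) (hd : 1 ≤ d) (hMa : a⁻¹ ≤ M) (hMb : b⁻¹ ≤ M) (hMc : c⁻¹ ≤ M) (hMd : d⁻¹ ≤ M) : |u| ≤ C * M ^ 4 := by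
  set m := min a (min b (min c d)) with hm
  have hm1 : 1 ≤ m := le_min ha (le_min hb (le_min hc hd))
  have hm0 : 0 < m := by linarith
  have hmem := hm.ge
  simp only [min_le_iff] at hmem
  have hmM : m⁻¹ ≤ M := by
    rcases hmem with e | e | e | e
    · exact (inv_anti₀ (by linarith) e).trans hMa
    · exact (inv_anti₀ (by linarith) e).trans hMb
    · exact (inv_anti₀ (by linarith) e).trans hMc
    · exact (inv_anti₀ (by linarith) e).trans hMd
  have hi0 : 0 ≤ m⁻¹ := inv_nonneg.mpr hm0.le
  have hi1 : m⁻¹ ≤ 1 := inv_le_one_of_one_le₀ hm1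
  have e6 : C' / m ^ 6 = C' * (m⁻¹) ^ 6 := by rw [div_eq_mul_inv, inv_pow]
  have h64 : (m⁻¹) ^ 6 ≤ (m⁻¹) ^ 4 := pow_le_pow_of_le_one hi0 hi1 (by norm_num)
  have h4M : (m⁻¹) ^ 4 ≤ M ^ 4 := pow_le_pow_left₀ hi0 hmM 4
  have hM4 : 0 ≤ M ^ 4 := le_trans (pow_nonneg hi0 4) h4M
  calc |u| ≤ C' / m ^ 6 := h
    _ = C' * (m⁻¹) ^ 6 := e6
    _ ≤ C' * M ^ 4 := mul_le_mul_of_nonneg_left (h64.trans h4M) hC'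
    _ ≤ C * M ^ 4 := mul_le_mul_of_nonneg_right hC hM4

/-- Six crossing weights: the same with `min(a,b,c,d,e,f)`. [folklore] -/
theorem cut_to_threshold6 {u C' C a b c d e f M : ℝ} (h : |u| ≤ C' / (min a (min b (min c (min d (min e f))))) ^ 6) (hC : C' ≤ C) (hC' : 0 ≤ C')
    (ha : 1 ≤ a) (hb : 1 ≤ b) (hc : 1 ≤ c) (hd : 1 ≤ d) (he : 1 ≤ e) (hf : 1 ≤ f) (hMa : a⁻¹ ≤ M) (hMb : b⁻¹ ≤ M) (hMc : c⁻¹ ≤ M) (hMd : d⁻¹ ≤ M)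
    (hMe : e⁻¹ ≤ M) (hMf : f⁻¹ ≤ M) : |u| ≤ C * M ^ 4 := by
  set m := min a (min b (min c (min d (min e f)))) with hm
  have hm1 : 1 ≤ m := le_min ha (le_min hb (le_min hc (le_min hd (le_min he hf))))
  have hm0 : 0 < m := by linarith
  have hmem := hm.ge
  simp only [min_le_iff] at hmem
  have hmM : m⁻¹ ≤ M := by
    rcases hmem with x | x | x | x | x | x
    · exact (inv_anti₀ (by linarith) x).trans hMa
    · exact (inv_anti₀ (by linarith) x).trans hMb
    · exact (inv_anti₀ (by linarith) x).trans hMc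
    · exact (inv_anti₀ (by linarith) x).trans hMd
    · exact (inv_anti₀ (by linarith) x).trans hMe
    · exact (inv_anti₀ (by linarith) x).trans hMf
  have hi0 : 0 ≤ m⁻¹ := inv_nonneg.mpr hm0.le
  have hi1 : m⁻¹ ≤ 1 := inv_le_one_of_one_le₀ hm1
  have e6 : C' / m ^ 6 = C' * (m⁻¹) ^ 6 := by rw [div_eq_mul_inv, inv_pow]
  have h64 : (m⁻¹) ^ 6 ≤ (m⁻¹) ^ 4 := pow_le_pow_of_le_one hi0 hi1 (by norm_num)
  have h4M : (m⁻¹) ^ 4 ≤ M ^ 4 := pow_le_pow_left₀ hi0 hmM 4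
  have hM4 : 0 ≤ M ^ 4 := le_trans (pow_nonneg hi0 4) h4M
  calc |u| ≤ C' / m ^ 6 := h
    _ = C' * (m⁻¹) ^ 6 := e6
    _ ≤ C' * M ^ 4 := mul_le_mul_of_nonneg_left (h64.trans h4M) hC'
    _ ≤ C * M ^ 4 := mul_le_mul_of_nonneg_right hC hM4

/-! ## §2. THE END: the threshold bound -/

variable {ι : Type} [Fintype ι] [DecidableEq ι]

variable {V : (ι → ℝ) → ℝ} {V₁ : ι → (ι → ℝ) → ℝ} {c : ι → ℝ} {Cw γ : ℝ} {J D : ι → ι → ℝ}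
  {P : ι → ((ι → ℝ) → ℝ) → ((ι → ℝ) → ℝ)} {F₁ F₂ F₃ F₄ F₅ : (ι → ℝ) → ℝ} {a₁ a₂ a₃ a₄ a₅ : ι → ℝ}

set_option maxHeartbeats 800000 in
/-- **THE END — THRESHOLD DECAY OF THE FIFTH CUMULANT**: `|u₅| ≤ (C₁ + C₂)·t⋆⁴`, `t⋆ = min_S max_{e crossing S} r_e⁻¹`. [folklore] -/
theorem fifth_cumulant_threshold_bound
    (hP : ∀ x F ω, P x F ω = (∫ s, F (update ω x s) * exp (-V (update ω x s))) / ∫ s, exp (-V (update ω x s)))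
    (hV : ∀ x ω, HasDerivAt (fun s => V (update ω x s)) (V₁ x ω) (ω x))
    (hfloor : ∀ x ω s t, c x * (s - t) ^ 2 ≤ (V₁ x (update ω x s) - V₁ x (update ω x t)) * (s - t)) (hc : ∀ x, 0 < c x)
    (hceil : ∀ x ω s t, |V₁ x (update ω x s) - V₁ x (update ω x t)| ≤ Cw * |s - t|)
    (hcross : ∀ x z, z ≠ x → ∀ ω s t, |V₁ x (update ω z s) - V₁ x (update ω z t)| ≤ J x z * |s - t|) (hVc : Continuous V)
    (hV0 : Integrable (fun ω : ι → ℝ => exp (-V ω))) (hV2 : ∀ z, Integrable (fun ω : ι → ℝ => ω z ^ 2 * exp (-V ω)))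
    (hJ : ∀ x z, 0 ≤ J x z) (hJ0 : ∀ x, J x x = 0) (hrow : ∀ x, ∑ z, J x z / c x ≤ γ) (hγ0 : 0 ≤ γ) (hγ1 : γ < 1)
    (hD : ∀ x y, 0 ≤ D x y) (hDC : ∀ x y, (if x = y then (1 : ℝ) else 0) + ∑ z, D x z * (J z y / c z) ≤ D x y)
    (h1 : ∀ z ω s t, |F₁ (update ω z s) - F₁ (update ω z t)| ≤ a₁ z * |s - t|)
    (h2 : ∀ z ω s t, |F₂ (update ω z s) - F₂ (update ω z t)| ≤ a₂ z * |s - t|)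
    (h3 : ∀ z ω s t, |F₃ (update ω z s) - F₃ (update ω z t)| ≤ a₃ z * |s - t|)
    (h4 : ∀ z ω s t, |F₄ (update ω z s) - F₄ (update ω z t)| ≤ a₄ z * |s - t|)
    (h5 : ∀ z ω s t, |F₅ (update ω z s) - F₅ (update ω z t)| ≤ a₅ z * |s - t|)
    {K r12 r13 r14 r15 r23 r24 r25 r34 r35 r45 M₂ M₄ M₆ : ℝ} (hK : 0 ≤ K)
    (hr12 : 1 ≤ r12) (hr13 : 1 ≤ r13) (hr14 : 1 ≤ r14) (hr15 : 1 ≤ r15) (hr23 : 1 ≤ r23) (hr24 : 1 ≤ r24) (hr25 : 1 ≤ r25) (hr34 : 1 ≤ r34) (hr35 : 1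
        ≤ r35) (hr45 : 1 ≤ r45)
    (hB12 : (∑ w, (∑ z, D z w * a₁ z) * (∑ z, D z w * a₂ z) / c w) ≤ K / r12 ^ 24)
    (hB13 : (∑ w, (∑ z, D z w * a₁ z) * (∑ z, D z w * a₃ z) / c w) ≤ K / r13 ^ 24)
    (hB14 : (∑ w, (∑ z, D z w * a₁ z) * (∑ z, D z w * a₄ z) / c w) ≤ K / r14 ^ 24)
    (hB15 : (∑ w, (∑ z, D z w * a₁ z) * (∑ z, D z w * a₅ z) / c w) ≤ K / r15 ^ 24)
    (hB23 : (∑ w, (∑ z, D z w * a₂ z) * (∑ z, D z w * a₃ z) / c w) ≤ K / r23 ^ 24)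
    (hB24 : (∑ w, (∑ z, D z w * a₂ z) * (∑ z, D z w * a₄ z) / c w) ≤ K / r24 ^ 24)
    (hB25 : (∑ w, (∑ z, D z w * a₂ z) * (∑ z, D z w * a₅ z) / c w) ≤ K / r25 ^ 24)
    (hB34 : (∑ w, (∑ z, D z w * a₃ z) * (∑ z, D z w * a₄ z) / c w) ≤ K / r34 ^ 24)
    (hB35 : (∑ w, (∑ z, D z w * a₃ z) * (∑ z, D z w * a₅ z) / c w) ≤ K / r35 ^ 24)
    (hB45 : (∑ w, (∑ z, D z w * a₄ z) * (∑ z, D z w * a₅ z) / c w) ≤ K / r45 ^ 24)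
    (hq1 : Integrable (fun ω => (F₁ ω - (∫ ω', F₁ ω' ∂((volume : Measure (ι → ℝ)).tilted fun ω => -V ω))) ^ 4) ((volume : Measure (ι → ℝ)).tilted fun
        ω => -V ω))
    (hq2 : Integrable (fun ω => (F₂ ω - (∫ ω', F₂ ω' ∂((volume : Measure (ι → ℝ)).tilted fun ω => -V ω))) ^ 4) ((volume : Measure (ι → ℝ)).tilted fun
        ω => -V ω))
    (hq3 : Integrable (fun ω => (F₃ ω - (∫ ω', F₃ ω' ∂((volume : Measure (ι → ℝ)).tilted fun ω => -V ω))) ^ 4) ((volume : Measure (ι → ℝ)).tilted fun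
        ω => -V ω))
    (hq4 : Integrable (fun ω => (F₄ ω - (∫ ω', F₄ ω' ∂((volume : Measure (ι → ℝ)).tilted fun ω => -V ω))) ^ 4) ((volume : Measure (ι → ℝ)).tilted fun
        ω => -V ω))
    (hq5 : Integrable (fun ω => (F₅ ω - (∫ ω', F₅ ω' ∂((volume : Measure (ι → ℝ)).tilted fun ω => -V ω))) ^ 4) ((volume : Measure (ι → ℝ)).tilted fun
        ω => -V ω))
    (hs1 : Integrable (fun ω => (F₁ ω - (∫ ω', F₁ ω' ∂((volume : Measure (ι → ℝ)).tilted fun ω => -V ω))) ^ 6) ((volume : Measure (ι → ℝ)).tilted fun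
        ω => -V ω))
    (hs2 : Integrable (fun ω => (F₂ ω - (∫ ω', F₂ ω' ∂((volume : Measure (ι → ℝ)).tilted fun ω => -V ω))) ^ 6) ((volume : Measure (ι → ℝ)).tilted fun
        ω => -V ω))
    (hs3 : Integrable (fun ω => (F₃ ω - (∫ ω', F₃ ω' ∂((volume : Measure (ι → ℝ)).tilted fun ω => -V ω))) ^ 6) ((volume : Measure (ι → ℝ)).tilted fun
        ω => -V ω))
    (hs4 : Integrable (fun ω => (F₄ ω - (∫ ω', F₄ ω' ∂((volume : Measure (ι → ℝ)).tilted fun ω => -V ω))) ^ 6) ((volume : Measure (ι → ℝ)).tilted fun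
        ω => -V ω))
    (hs5 : Integrable (fun ω => (F₅ ω - (∫ ω', F₅ ω' ∂((volume : Measure (ι → ℝ)).tilted fun ω => -V ω))) ^ 6) ((volume : Measure (ι → ℝ)).tilted fun
        ω => -V ω))
    (hM21 : ∫ ω, (F₁ ω - (∫ ω', F₁ ω' ∂((volume : Measure (ι → ℝ)).tilted fun ω => -V ω))) ^ 2 ∂((volume : Measure (ι → ℝ)).tilted fun ω => -V ω) ≤
        M₂)
    (hM22 : ∫ ω, (F₂ ω - (∫ ω', F₂ ω' ∂((volume : Measure (ι → ℝ)).tilted fun ω => -V ω))) ^ 2 ∂((volume : Measure (ι → ℝ)).tilted fun ω => -V ω) ≤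
        M₂)
    (hM23 : ∫ ω, (F₃ ω - (∫ ω', F₃ ω' ∂((volume : Measure (ι → ℝ)).tilted fun ω => -V ω))) ^ 2 ∂((volume : Measure (ι → ℝ)).tilted fun ω => -V ω) ≤
        M₂)
    (hM24 : ∫ ω, (F₄ ω - (∫ ω', F₄ ω' ∂((volume : Measure (ι → ℝ)).tilted fun ω => -V ω))) ^ 2 ∂((volume : Measure (ι → ℝ)).tilted fun ω => -V ω) ≤
        M₂)
    (hM25 : ∫ ω, (F₅ ω - (∫ ω', F₅ ω' ∂((volume : Measure (ι → ℝ)).tilted fun ω => -V ω))) ^ 2 ∂((volume : Measure (ι → ℝ)).tilted fun ω => -V ω) ≤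
        M₂)
    (hM41 : ∫ ω, (F₁ ω - (∫ ω', F₁ ω' ∂((volume : Measure (ι → ℝ)).tilted fun ω => -V ω))) ^ 4 ∂((volume : Measure (ι → ℝ)).tilted fun ω => -V ω) ≤
        M₄)
    (hM42 : ∫ ω, (F₂ ω - (∫ ω', F₂ ω' ∂((volume : Measure (ι → ℝ)).tilted fun ω => -V ω))) ^ 4 ∂((volume : Measure (ι → ℝ)).tilted fun ω => -V ω) ≤
        M₄)
    (hM43 : ∫ ω, (F₃ ω - (∫ ω', F₃ ω' ∂((volume : Measure (ι → ℝ)).tilted fun ω => -V ω))) ^ 4 ∂((volume : Measure (ι → ℝ)).tilted fun ω => -V ω) ≤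
        M₄)
    (hM44 : ∫ ω, (F₄ ω - (∫ ω', F₄ ω' ∂((volume : Measure (ι → ℝ)).tilted fun ω => -V ω))) ^ 4 ∂((volume : Measure (ι → ℝ)).tilted fun ω => -V ω) ≤
        M₄)
    (hM45 : ∫ ω, (F₅ ω - (∫ ω', F₅ ω' ∂((volume : Measure (ι → ℝ)).tilted fun ω => -V ω))) ^ 4 ∂((volume : Measure (ι → ℝ)).tilted fun ω => -V ω) ≤
        M₄)
    (hM61 : ∫ ω, (F₁ ω - (∫ ω', F₁ ω' ∂((volume : Measure (ι → ℝ)).tilted fun ω => -V ω))) ^ 6 ∂((volume : Measure (ι → ℝ)).tilted fun ω => -V ω) ≤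
        M₆)
    (hM62 : ∫ ω, (F₂ ω - (∫ ω', F₂ ω' ∂((volume : Measure (ι → ℝ)).tilted fun ω => -V ω))) ^ 6 ∂((volume : Measure (ι → ℝ)).tilted fun ω => -V ω) ≤
        M₆)
    (hM63 : ∫ ω, (F₃ ω - (∫ ω', F₃ ω' ∂((volume : Measure (ι → ℝ)).tilted fun ω => -V ω))) ^ 6 ∂((volume : Measure (ι → ℝ)).tilted fun ω => -V ω) ≤
        M₆)
    (hM64 : ∫ ω, (F₄ ω - (∫ ω', F₄ ω' ∂((volume : Measure (ι → ℝ)).tilted fun ω => -V ω))) ^ 6 ∂((volume : Measure (ι → ℝ)).tilted fun ω => -V ω) ≤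
        M₆)
    (hM65 : ∫ ω, (F₅ ω - (∫ ω', F₅ ω' ∂((volume : Measure (ι → ℝ)).tilted fun ω => -V ω))) ^ 6 ∂((volume : Measure (ι → ℝ)).tilted fun ω => -V ω) ≤
        M₆) :
    |(∫ ω, (F₁ ω - (∫ ω', F₁ ω' ∂((volume : Measure (ι → ℝ)).tilted fun ω => -V ω))) * (F₂ ω - (∫ ω', F₂ ω' ∂((volume : Measure (ι → ℝ)).tilted fun ω
        => -V ω))) * (F₃ ω - (∫ ω', F₃ ω' ∂((volume : Measure (ι → ℝ)).tilted fun ω => -V ω))) * (F₄ ω - (∫ ω', F₄ ω' ∂((volume : Measure (ι →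
        ℝ)).tilted fun ω => -V ω))) * (F₅ ω - (∫ ω', F₅ ω' ∂((volume : Measure (ι → ℝ)).tilted fun ω => -V ω))) ∂((volume : Measure (ι → ℝ)).tilted
        fun ω => -V ω)) -
        ((∫ ω, (F₁ ω - (∫ ω', F₁ ω' ∂((volume : Measure (ι → ℝ)).tilted fun ω => -V ω))) * (F₂ ω - (∫ ω', F₂ ω' ∂((volume : Measure (ι → ℝ)).tilted
            fun ω => -V ω))) ∂((volume : Measure (ι → ℝ)).tilted fun ω => -V ω)) * (∫ ω, (F₃ ω - (∫ ω', F₃ ω' ∂((volume : Measure (ι → ℝ)).tilted fun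
            ω => -V ω))) * (F₄ ω - (∫ ω', F₄ ω' ∂((volume : Measure (ι → ℝ)).tilted fun ω => -V ω))) * (F₅ ω - (∫ ω', F₅ ω' ∂((volume : Measure (ι →
            ℝ)).tilted fun ω => -V ω))) ∂((volume : Measure (ι → ℝ)).tilted fun ω => -V ω)) +
        (∫ ω, (F₁ ω - (∫ ω', F₁ ω' ∂((volume : Measure (ι → ℝ)).tilted fun ω => -V ω))) * (F₃ ω - (∫ ω', F₃ ω' ∂((volume : Measure (ι → ℝ)).tilted
            fun ω => -V ω))) ∂((volume : Measure (ι → ℝ)).tilted fun ω => -V ω)) * (∫ ω, (F₂ ω - (∫ ω', F₂ ω' ∂((volume : Measure (ι → ℝ)).tilted fun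
            ω => -V ω))) * (F₄ ω - (∫ ω', F₄ ω' ∂((volume : Measure (ι → ℝ)).tilted fun ω => -V ω))) * (F₅ ω - (∫ ω', F₅ ω' ∂((volume : Measure (ι →
            ℝ)).tilted fun ω => -V ω))) ∂((volume : Measure (ι → ℝ)).tilted fun ω => -V ω)) +
        (∫ ω, (F₁ ω - (∫ ω', F₁ ω' ∂((volume : Measure (ι → ℝ)).tilted fun ω => -V ω))) * (F₄ ω - (∫ ω', F₄ ω' ∂((volume : Measure (ι → ℝ)).tilted
            fun ω => -V ω))) ∂((volume : Measure (ι → ℝ)).tilted fun ω => -V ω)) * (∫ ω, (F₂ ω - (∫ ω', F₂ ω' ∂((volume : Measure (ι → ℝ)).tilted fun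
            ω => -V ω))) * (F₃ ω - (∫ ω', F₃ ω' ∂((volume : Measure (ι → ℝ)).tilted fun ω => -V ω))) * (F₅ ω - (∫ ω', F₅ ω' ∂((volume : Measure (ι →
            ℝ)).tilted fun ω => -V ω))) ∂((volume : Measure (ι → ℝ)).tilted fun ω => -V ω)) +
        (∫ ω, (F₁ ω - (∫ ω', F₁ ω' ∂((volume : Measure (ι → ℝ)).tilted fun ω => -V ω))) * (F₅ ω - (∫ ω', F₅ ω' ∂((volume : Measure (ι → ℝ)).tilted
            fun ω => -V ω))) ∂((volume : Measure (ι → ℝ)).tilted fun ω => -V ω)) * (∫ ω, (F₂ ω - (∫ ω', F₂ ω' ∂((volume : Measure (ι → ℝ)).tilted fun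
            ω => -V ω))) * (F₃ ω - (∫ ω', F₃ ω' ∂((volume : Measure (ι → ℝ)).tilted fun ω => -V ω))) * (F₄ ω - (∫ ω', F₄ ω' ∂((volume : Measure (ι →
            ℝ)).tilted fun ω => -V ω))) ∂((volume : Measure (ι → ℝ)).tilted fun ω => -V ω)) +
        (∫ ω, (F₂ ω - (∫ ω', F₂ ω' ∂((volume : Measure (ι → ℝ)).tilted fun ω => -V ω))) * (F₃ ω - (∫ ω', F₃ ω' ∂((volume : Measure (ι → ℝ)).tilted
            fun ω => -V ω))) ∂((volume : Measure (ι → ℝ)).tilted fun ω => -V ω)) * (∫ ω, (F₁ ω - (∫ ω', F₁ ω' ∂((volume : Measure (ι → ℝ)).tilted fun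
            ω => -V ω))) * (F₄ ω - (∫ ω', F₄ ω' ∂((volume : Measure (ι → ℝ)).tilted fun ω => -V ω))) * (F₅ ω - (∫ ω', F₅ ω' ∂((volume : Measure (ι →
            ℝ)).tilted fun ω => -V ω))) ∂((volume : Measure (ι → ℝ)).tilted fun ω => -V ω)) +
        (∫ ω, (F₂ ω - (∫ ω', F₂ ω' ∂((volume : Measure (ι → ℝ)).tilted fun ω => -V ω))) * (F₄ ω - (∫ ω', F₄ ω' ∂((volume : Measure (ι → ℝ)).tilted
            fun ω => -V ω))) ∂((volume : Measure (ι → ℝ)).tilted fun ω => -V ω)) * (∫ ω, (F₁ ω - (∫ ω', F₁ ω' ∂((volume : Measure (ι → ℝ)).tilted fun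
            ω => -V ω))) * (F₃ ω - (∫ ω', F₃ ω' ∂((volume : Measure (ι → ℝ)).tilted fun ω => -V ω))) * (F₅ ω - (∫ ω', F₅ ω' ∂((volume : Measure (ι →
            ℝ)).tilted fun ω => -V ω))) ∂((volume : Measure (ι → ℝ)).tilted fun ω => -V ω)) +
        (∫ ω, (F₂ ω - (∫ ω', F₂ ω' ∂((volume : Measure (ι → ℝ)).tilted fun ω => -V ω))) * (F₅ ω - (∫ ω', F₅ ω' ∂((volume : Measure (ι → ℝ)).tilted
            fun ω => -V ω))) ∂((volume : Measure (ι → ℝ)).tilted fun ω => -V ω)) * (∫ ω, (F₁ ω - (∫ ω', F₁ ω' ∂((volume : Measure (ι → ℝ)).tilted fun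
            ω => -V ω))) * (F₃ ω - (∫ ω', F₃ ω' ∂((volume : Measure (ι → ℝ)).tilted fun ω => -V ω))) * (F₄ ω - (∫ ω', F₄ ω' ∂((volume : Measure (ι →
            ℝ)).tilted fun ω => -V ω))) ∂((volume : Measure (ι → ℝ)).tilted fun ω => -V ω)) +
        (∫ ω, (F₃ ω - (∫ ω', F₃ ω' ∂((volume : Measure (ι → ℝ)).tilted fun ω => -V ω))) * (F₄ ω - (∫ ω', F₄ ω' ∂((volume : Measure (ι → ℝ)).tilted
            fun ω => -V ω))) ∂((volume : Measure (ι → ℝ)).tilted fun ω => -V ω)) * (∫ ω, (F₁ ω - (∫ ω', F₁ ω' ∂((volume : Measure (ι → ℝ)).tilted fun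
            ω => -V ω))) * (F₂ ω - (∫ ω', F₂ ω' ∂((volume : Measure (ι → ℝ)).tilted fun ω => -V ω))) * (F₅ ω - (∫ ω', F₅ ω' ∂((volume : Measure (ι →
            ℝ)).tilted fun ω => -V ω))) ∂((volume : Measure (ι → ℝ)).tilted fun ω => -V ω)) +
        (∫ ω, (F₃ ω - (∫ ω', F₃ ω' ∂((volume : Measure (ι → ℝ)).tilted fun ω => -V ω))) * (F₅ ω - (∫ ω', F₅ ω' ∂((volume : Measure (ι → ℝ)).tilted
            fun ω => -V ω))) ∂((volume : Measure (ι → ℝ)).tilted fun ω => -V ω)) * (∫ ω, (F₁ ω - (∫ ω', F₁ ω' ∂((volume : Measure (ι → ℝ)).tilted fun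
            ω => -V ω))) * (F₂ ω - (∫ ω', F₂ ω' ∂((volume : Measure (ι → ℝ)).tilted fun ω => -V ω))) * (F₄ ω - (∫ ω', F₄ ω' ∂((volume : Measure (ι →
            ℝ)).tilted fun ω => -V ω))) ∂((volume : Measure (ι → ℝ)).tilted fun ω => -V ω)) +
        (∫ ω, (F₄ ω - (∫ ω', F₄ ω' ∂((volume : Measure (ι → ℝ)).tilted fun ω => -V ω))) * (F₅ ω - (∫ ω', F₅ ω' ∂((volume : Measure (ι → ℝ)).tilted
            fun ω => -V ω))) ∂((volume : Measure (ι → ℝ)).tilted fun ω => -V ω)) * (∫ ω, (F₁ ω - (∫ ω', F₁ ω' ∂((volume : Measure (ι → ℝ)).tilted fun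
            ω => -V ω))) * (F₂ ω - (∫ ω', F₂ ω' ∂((volume : Measure (ι → ℝ)).tilted fun ω => -V ω))) * (F₃ ω - (∫ ω', F₃ ω' ∂((volume : Measure (ι →
            ℝ)).tilted fun ω => -V ω))) ∂((volume : Measure (ι → ℝ)).tilted fun ω => -V ω)))| ≤
      ((4 * K + 5 * M₆ + M₂ * M₄ + 2 * K * (M₂ + M₄) + 24 * M₂ * Real.sqrt (K * M₄)) + (6 * K + 5 * M₆ + (M₂ + M₄) ^ 2 / 2 + 3 * M₂ * M₄ + 3 * K *
          (M₂ + M₄) + 12 * M₂ * Real.sqrt (K * M₄))) *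
        (min (max (r12)⁻¹ (max (r13)⁻¹ (max (r14)⁻¹ (r15)⁻¹))) (min (max (r13)⁻¹ (max (r23)⁻¹ (max (r14)⁻¹ (max (r24)⁻¹ (max (r15)⁻¹ (r25)⁻¹)))))
            (min (max (r12)⁻¹ (max (r23)⁻¹ (max (r14)⁻¹ (max (r34)⁻¹ (max (r15)⁻¹ (r35)⁻¹))))) (min (max (r12)⁻¹ (max (r24)⁻¹ (max (r13)⁻¹ (max
            (r34)⁻¹ (max (r15)⁻¹ (r45)⁻¹))))) (min (max (r12)⁻¹ (max (r25)⁻¹ (max (r13)⁻¹ (max (r35)⁻¹ (max (r14)⁻¹ (r45)⁻¹))))) (min (max (r14)⁻¹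
            (max (r24)⁻¹ (max (r34)⁻¹ (max (r15)⁻¹ (max (r25)⁻¹ (r35)⁻¹))))) (min (max (r13)⁻¹ (max (r23)⁻¹ (max (r34)⁻¹ (max (r15)⁻¹ (max (r25)⁻¹
            (r45)⁻¹))))) (min (max (r13)⁻¹ (max (r23)⁻¹ (max (r35)⁻¹ (max (r14)⁻¹ (max (r24)⁻¹ (r45)⁻¹))))) (min (max (r12)⁻¹ (max (r23)⁻¹ (max
            (r24)⁻¹ (max (r15)⁻¹ (max (r35)⁻¹ (r45)⁻¹))))) (min (max (r12)⁻¹ (max (r23)⁻¹ (max (r25)⁻¹ (max (r14)⁻¹ (max (r34)⁻¹ (r45)⁻¹))))) (min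
            (max (r12)⁻¹ (max (r24)⁻¹ (max (r25)⁻¹ (max (r13)⁻¹ (max (r34)⁻¹ (r35)⁻¹))))) (min (max (r15)⁻¹ (max (r25)⁻¹ (max (r35)⁻¹ (r45)⁻¹))) (min
            (max (r14)⁻¹ (max (r24)⁻¹ (max (r34)⁻¹ (r45)⁻¹))) (min (max (r13)⁻¹ (max (r23)⁻¹ (max (r34)⁻¹ (r35)⁻¹))) (max (r12)⁻¹ (max (r23)⁻¹ (max
            (r24)⁻¹ (r25)⁻¹))))))))))))))))) ^ 4 := by
  have hM2nn : 0 ≤ M₂ := le_trans (integral_nonneg fun ω => sq_nonneg _) hM21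
  have hM4nn : 0 ≤ M₄ := le_trans (integral_nonneg fun ω => by positivity) hM41
  have hM6nn : 0 ≤ M₆ := le_trans (integral_nonneg fun ω => by positivity) hM61
  have hC1 : 0 ≤ (4 * K + 5 * M₆ + M₂ * M₄ + 2 * K * (M₂ + M₄) + 24 * M₂ * Real.sqrt (K * M₄)) := by positivity
  have hC2 : 0 ≤ (6 * K + 5 * M₆ + (M₂ + M₄) ^ 2 / 2 + 3 * M₂ * M₄ + 3 * K * (M₂ + M₄) + 12 * M₂ * Real.sqrt (K * M₄)) := by positivity
  set C5 : ℝ := (4 * K + 5 * M₆ + M₂ * M₄ + 2 * K * (M₂ + M₄) + 24 * M₂ * Real.sqrt (K * M₄)) + (6 * K + 5 * M₆ + (M₂ + M₄) ^ 2 / 2 + 3 * M₂ * M₄ + 3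
      * K * (M₂ + M₄) + 12 * M₂ * Real.sqrt (K * M₄)) with hC5
  have hC1le : (4 * K + 5 * M₆ + M₂ * M₄ + 2 * K * (M₂ + M₄) + 24 * M₂ * Real.sqrt (K * M₄)) ≤ C5 := le_add_of_nonneg_right hC2
  have hC2le : (6 * K + 5 * M₆ + (M₂ + M₄) ^ 2 / 2 + 3 * M₂ * M₄ + 3 * K * (M₂ + M₄) + 12 * M₂ * Real.sqrt (K * M₄)) ≤ C5 := le_add_of_nonneg_left hC1
  have hu1 := cut_to_threshold4 (fifth_cumulant_single_cut hP hV hfloor hc hceil hcross hVc hV0 hV2 hJ hJ0 hrow hγ0 hγ1 hD hDC h1 h2 h3 h4 h5 hK hr12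
      hr13 hr14 hr15 hB12 hB13 hB14 hB15 hq1 hq2 hq3 hq4 hq5 hs1 hs2 hs3 hs4 hs5 hM21 hM22 hM23 hM24 hM25 hM41 hM42 hM43 hM44 hM45 hM61 hM62 hM63
      hM64 hM65) hC1le hC1 hr12 hr13 hr14 hr15 (le_max_left _ _ : (r12)⁻¹ ≤ max (r12)⁻¹ (max (r13)⁻¹ (max (r14)⁻¹ (r15)⁻¹))) (le_max_of_le_right
      (le_max_left _ _)) (le_max_of_le_right (le_max_of_le_right (le_max_left _ _))) (le_max_of_le_right (le_max_of_le_right (le_max_right _ _)))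
  have hu12 := cut_to_threshold6 (fifth_cumulant_pair_cut hP hV hfloor hc hceil hcross hVc hV0 hV2 hJ hJ0 hrow hγ0 hγ1 hD hDC h1 h2 h3 h4 h5 hK hr13
      hr14 hr15 hr23 hr24 hr25 hB13 hB14 hB15 hB23 hB24 hB25 hq1 hq2 hq3 hq4 hq5 hs1 hs2 hs3 hs4 hs5 hM21 hM22 hM23 hM24 hM25 hM41 hM42 hM43 hM44
      hM45 hM61 hM62 hM63 hM64 hM65) hC2le hC2 hr13 hr14 hr15 hr23 hr24 hr25 (le_max_left _ _ : (r13)⁻¹ ≤ max (r13)⁻¹ (max (r23)⁻¹ (max (r14)⁻¹ (max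
      (r24)⁻¹ (max (r15)⁻¹ (r25)⁻¹))))) (le_max_of_le_right (le_max_of_le_right (le_max_left _ _))) (le_max_of_le_right (le_max_of_le_right
      (le_max_of_le_right (le_max_of_le_right (le_max_left _ _))))) (le_max_of_le_right (le_max_left _ _)) (le_max_of_le_right (le_max_of_le_right
      (le_max_of_le_right (le_max_left _ _)))) (le_max_of_le_right (le_max_of_le_right (le_max_of_le_right (le_max_of_le_right (le_max_right _ _)))))
  have hu13 := cut_to_threshold6 (fifth_cumulant_pair_cut_13 hP hV hfloor hc hceil hcross hVc hV0 hV2 hJ hJ0 hrow hγ0 hγ1 hD hDC h1 h2 h3 h4 h5 hK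
      hr12 hr14 hr15 hr23 hr34 hr35 hB12 hB14 hB15 hB23 hB34 hB35 hq1 hq2 hq3 hq4 hq5 hs1 hs2 hs3 hs4 hs5 hM21 hM22 hM23 hM24 hM25 hM41 hM42 hM43
      hM44 hM45 hM61 hM62 hM63 hM64 hM65) hC2le hC2 hr12 hr14 hr15 hr23 hr34 hr35 (le_max_left _ _ : (r12)⁻¹ ≤ max (r12)⁻¹ (max (r23)⁻¹ (max (r14)⁻¹
      (max (r34)⁻¹ (max (r15)⁻¹ (r35)⁻¹))))) (le_max_of_le_right (le_max_of_le_right (le_max_left _ _))) (le_max_of_le_right (le_max_of_le_right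
      (le_max_of_le_right (le_max_of_le_right (le_max_left _ _))))) (le_max_of_le_right (le_max_left _ _)) (le_max_of_le_right (le_max_of_le_right
      (le_max_of_le_right (le_max_left _ _)))) (le_max_of_le_right (le_max_of_le_right (le_max_of_le_right (le_max_of_le_right (le_max_right _ _)))))
  have hu14 := cut_to_threshold6 (fifth_cumulant_pair_cut_14 hP hV hfloor hc hceil hcross hVc hV0 hV2 hJ hJ0 hrow hγ0 hγ1 hD hDC h1 h2 h3 h4 h5 hK
      hr12 hr13 hr15 hr24 hr34 hr45 hB12 hB13 hB15 hB24 hB34 hB45 hq1 hq2 hq3 hq4 hq5 hs1 hs2 hs3 hs4 hs5 hM21 hM22 hM23 hM24 hM25 hM41 hM42 hM43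
      hM44 hM45 hM61 hM62 hM63 hM64 hM65) hC2le hC2 hr12 hr13 hr15 hr24 hr34 hr45 (le_max_left _ _ : (r12)⁻¹ ≤ max (r12)⁻¹ (max (r24)⁻¹ (max (r13)⁻¹
      (max (r34)⁻¹ (max (r15)⁻¹ (r45)⁻¹))))) (le_max_of_le_right (le_max_of_le_right (le_max_left _ _))) (le_max_of_le_right (le_max_of_le_right
      (le_max_of_le_right (le_max_of_le_right (le_max_left _ _))))) (le_max_of_le_right (le_max_left _ _)) (le_max_of_le_right (le_max_of_le_right
      (le_max_of_le_right (le_max_left _ _)))) (le_max_of_le_right (le_max_of_le_right (le_max_of_le_right (le_max_of_le_right (le_max_right _ _)))))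
  have hu15 := cut_to_threshold6 (fifth_cumulant_pair_cut_15 hP hV hfloor hc hceil hcross hVc hV0 hV2 hJ hJ0 hrow hγ0 hγ1 hD hDC h1 h2 h3 h4 h5 hK
      hr12 hr13 hr14 hr25 hr35 hr45 hB12 hB13 hB14 hB25 hB35 hB45 hq1 hq2 hq3 hq4 hq5 hs1 hs2 hs3 hs4 hs5 hM21 hM22 hM23 hM24 hM25 hM41 hM42 hM43
      hM44 hM45 hM61 hM62 hM63 hM64 hM65) hC2le hC2 hr12 hr13 hr14 hr25 hr35 hr45 (le_max_left _ _ : (r12)⁻¹ ≤ max (r12)⁻¹ (max (r25)⁻¹ (max (r13)⁻¹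
      (max (r35)⁻¹ (max (r14)⁻¹ (r45)⁻¹))))) (le_max_of_le_right (le_max_of_le_right (le_max_left _ _))) (le_max_of_le_right (le_max_of_le_right
      (le_max_of_le_right (le_max_of_le_right (le_max_left _ _))))) (le_max_of_le_right (le_max_left _ _)) (le_max_of_le_right (le_max_of_le_right
      (le_max_of_le_right (le_max_left _ _)))) (le_max_of_le_right (le_max_of_le_right (le_max_of_le_right (le_max_of_le_right (le_max_right _ _)))))
  have hu123 := cut_to_threshold6 (fifth_cumulant_pair_cut_45 hP hV hfloor hc hceil hcross hVc hV0 hV2 hJ hJ0 hrow hγ0 hγ1 hD hDC h1 h2 h3 h4 h5 hK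
      hr14 hr15 hr24 hr25 hr34 hr35 hB14 hB15 hB24 hB25 hB34 hB35 hq1 hq2 hq3 hq4 hq5 hs1 hs2 hs3 hs4 hs5 hM21 hM22 hM23 hM24 hM25 hM41 hM42 hM43
      hM44 hM45 hM61 hM62 hM63 hM64 hM65) hC2le hC2 hr14 hr24 hr34 hr15 hr25 hr35 (le_max_left _ _ : (r14)⁻¹ ≤ max (r14)⁻¹ (max (r24)⁻¹ (max (r34)⁻¹
      (max (r15)⁻¹ (max (r25)⁻¹ (r35)⁻¹))))) (le_max_of_le_right (le_max_left _ _)) (le_max_of_le_right (le_max_of_le_right (le_max_left _ _)))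
      (le_max_of_le_right (le_max_of_le_right (le_max_of_le_right (le_max_left _ _)))) (le_max_of_le_right (le_max_of_le_right (le_max_of_le_right
      (le_max_of_le_right (le_max_left _ _))))) (le_max_of_le_right (le_max_of_le_right (le_max_of_le_right (le_max_of_le_right (le_max_right _ _)))))
  have hu124 := cut_to_threshold6 (fifth_cumulant_pair_cut_35 hP hV hfloor hc hceil hcross hVc hV0 hV2 hJ hJ0 hrow hγ0 hγ1 hD hDC h1 h2 h3 h4 h5 hK
      hr13 hr15 hr23 hr25 hr34 hr45 hB13 hB15 hB23 hB25 hB34 hB45 hq1 hq2 hq3 hq4 hq5 hs1 hs2 hs3 hs4 hs5 hM21 hM22 hM23 hM24 hM25 hM41 hM42 hM43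
      hM44 hM45 hM61 hM62 hM63 hM64 hM65) hC2le hC2 hr13 hr23 hr34 hr15 hr25 hr45 (le_max_left _ _ : (r13)⁻¹ ≤ max (r13)⁻¹ (max (r23)⁻¹ (max (r34)⁻¹
      (max (r15)⁻¹ (max (r25)⁻¹ (r45)⁻¹))))) (le_max_of_le_right (le_max_left _ _)) (le_max_of_le_right (le_max_of_le_right (le_max_left _ _)))
      (le_max_of_le_right (le_max_of_le_right (le_max_of_le_right (le_max_left _ _)))) (le_max_of_le_right (le_max_of_le_right (le_max_of_le_right
      (le_max_of_le_right (le_max_left _ _))))) (le_max_of_le_right (le_max_of_le_right (le_max_of_le_right (le_max_of_le_right (le_max_right _ _)))))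
  have hu125 := cut_to_threshold6 (fifth_cumulant_pair_cut_34 hP hV hfloor hc hceil hcross hVc hV0 hV2 hJ hJ0 hrow hγ0 hγ1 hD hDC h1 h2 h3 h4 h5 hK
      hr13 hr14 hr23 hr24 hr35 hr45 hB13 hB14 hB23 hB24 hB35 hB45 hq1 hq2 hq3 hq4 hq5 hs1 hs2 hs3 hs4 hs5 hM21 hM22 hM23 hM24 hM25 hM41 hM42 hM43
      hM44 hM45 hM61 hM62 hM63 hM64 hM65) hC2le hC2 hr13 hr23 hr35 hr14 hr24 hr45 (le_max_left _ _ : (r13)⁻¹ ≤ max (r13)⁻¹ (max (r23)⁻¹ (max (r35)⁻¹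
      (max (r14)⁻¹ (max (r24)⁻¹ (r45)⁻¹))))) (le_max_of_le_right (le_max_left _ _)) (le_max_of_le_right (le_max_of_le_right (le_max_left _ _)))
      (le_max_of_le_right (le_max_of_le_right (le_max_of_le_right (le_max_left _ _)))) (le_max_of_le_right (le_max_of_le_right (le_max_of_le_right
      (le_max_of_le_right (le_max_left _ _))))) (le_max_of_le_right (le_max_of_le_right (le_max_of_le_right (le_max_of_le_right (le_max_right _ _)))))
  have hu134 := cut_to_threshold6 (fifth_cumulant_pair_cut_25 hP hV hfloor hc hceil hcross hVc hV0 hV2 hJ hJ0 hrow hγ0 hγ1 hD hDC h1 h2 h3 h4 h5 hK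
      hr12 hr15 hr23 hr24 hr35 hr45 hB12 hB15 hB23 hB24 hB35 hB45 hq1 hq2 hq3 hq4 hq5 hs1 hs2 hs3 hs4 hs5 hM21 hM22 hM23 hM24 hM25 hM41 hM42 hM43
      hM44 hM45 hM61 hM62 hM63 hM64 hM65) hC2le hC2 hr12 hr23 hr24 hr15 hr35 hr45 (le_max_left _ _ : (r12)⁻¹ ≤ max (r12)⁻¹ (max (r23)⁻¹ (max (r24)⁻¹
      (max (r15)⁻¹ (max (r35)⁻¹ (r45)⁻¹))))) (le_max_of_le_right (le_max_left _ _)) (le_max_of_le_right (le_max_of_le_right (le_max_left _ _)))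
      (le_max_of_le_right (le_max_of_le_right (le_max_of_le_right (le_max_left _ _)))) (le_max_of_le_right (le_max_of_le_right (le_max_of_le_right
      (le_max_of_le_right (le_max_left _ _))))) (le_max_of_le_right (le_max_of_le_right (le_max_of_le_right (le_max_of_le_right (le_max_right _ _)))))
  have hu135 := cut_to_threshold6 (fifth_cumulant_pair_cut_24 hP hV hfloor hc hceil hcross hVc hV0 hV2 hJ hJ0 hrow hγ0 hγ1 hD hDC h1 h2 h3 h4 h5 hK
      hr12 hr14 hr23 hr25 hr34 hr45 hB12 hB14 hB23 hB25 hB34 hB45 hq1 hq2 hq3 hq4 hq5 hs1 hs2 hs3 hs4 hs5 hM21 hM22 hM23 hM24 hM25 hM41 hM42 hM43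
      hM44 hM45 hM61 hM62 hM63 hM64 hM65) hC2le hC2 hr12 hr23 hr25 hr14 hr34 hr45 (le_max_left _ _ : (r12)⁻¹ ≤ max (r12)⁻¹ (max (r23)⁻¹ (max (r25)⁻¹
      (max (r14)⁻¹ (max (r34)⁻¹ (r45)⁻¹))))) (le_max_of_le_right (le_max_left _ _)) (le_max_of_le_right (le_max_of_le_right (le_max_left _ _)))
      (le_max_of_le_right (le_max_of_le_right (le_max_of_le_right (le_max_left _ _)))) (le_max_of_le_right (le_max_of_le_right (le_max_of_le_right
      (le_max_of_le_right (le_max_left _ _))))) (le_max_of_le_right (le_max_of_le_right (le_max_of_le_right (le_max_of_le_right (le_max_right _ _)))))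
  have hu145 := cut_to_threshold6 (fifth_cumulant_pair_cut_23 hP hV hfloor hc hceil hcross hVc hV0 hV2 hJ hJ0 hrow hγ0 hγ1 hD hDC h1 h2 h3 h4 h5 hK
      hr12 hr13 hr24 hr25 hr34 hr35 hB12 hB13 hB24 hB25 hB34 hB35 hq1 hq2 hq3 hq4 hq5 hs1 hs2 hs3 hs4 hs5 hM21 hM22 hM23 hM24 hM25 hM41 hM42 hM43
      hM44 hM45 hM61 hM62 hM63 hM64 hM65) hC2le hC2 hr12 hr24 hr25 hr13 hr34 hr35 (le_max_left _ _ : (r12)⁻¹ ≤ max (r12)⁻¹ (max (r24)⁻¹ (max (r25)⁻¹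
      (max (r13)⁻¹ (max (r34)⁻¹ (r35)⁻¹))))) (le_max_of_le_right (le_max_left _ _)) (le_max_of_le_right (le_max_of_le_right (le_max_left _ _)))
      (le_max_of_le_right (le_max_of_le_right (le_max_of_le_right (le_max_left _ _)))) (le_max_of_le_right (le_max_of_le_right (le_max_of_le_right
      (le_max_of_le_right (le_max_left _ _))))) (le_max_of_le_right (le_max_of_le_right (le_max_of_le_right (le_max_of_le_right (le_max_right _ _)))))
  have hu1234 := cut_to_threshold4 (fifth_cumulant_single_cut_5 hP hV hfloor hc hceil hcross hVc hV0 hV2 hJ hJ0 hrow hγ0 hγ1 hD hDC h1 h2 h3 h4 h5 hK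
      hr15 hr25 hr35 hr45 hB15 hB25 hB35 hB45 hq1 hq2 hq3 hq4 hq5 hs1 hs2 hs3 hs4 hs5 hM21 hM22 hM23 hM24 hM25 hM41 hM42 hM43 hM44 hM45 hM61 hM62
      hM63 hM64 hM65) hC1le hC1 hr25 hr35 hr45 hr15 (le_max_of_le_right (le_max_left _ _) : (r25)⁻¹ ≤ max (r15)⁻¹ (max (r25)⁻¹ (max (r35)⁻¹
      (r45)⁻¹))) (le_max_of_le_right (le_max_of_le_right (le_max_left _ _))) (le_max_of_le_right (le_max_of_le_right (le_max_right _ _)))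
      (le_max_left _ _)
  have hu1235 := cut_to_threshold4 (fifth_cumulant_single_cut_4 hP hV hfloor hc hceil hcross hVc hV0 hV2 hJ hJ0 hrow hγ0 hγ1 hD hDC h1 h2 h3 h4 h5 hK
      hr14 hr24 hr34 hr45 hB14 hB24 hB34 hB45 hq1 hq2 hq3 hq4 hq5 hs1 hs2 hs3 hs4 hs5 hM21 hM22 hM23 hM24 hM25 hM41 hM42 hM43 hM44 hM45 hM61 hM62
      hM63 hM64 hM65) hC1le hC1 hr24 hr34 hr14 hr45 (le_max_of_le_right (le_max_left _ _) : (r24)⁻¹ ≤ max (r14)⁻¹ (max (r24)⁻¹ (max (r34)⁻¹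
      (r45)⁻¹))) (le_max_of_le_right (le_max_of_le_right (le_max_left _ _))) (le_max_left _ _) (le_max_of_le_right (le_max_of_le_right (le_max_right
      _ _)))
  have hu1245 := cut_to_threshold4 (fifth_cumulant_single_cut_3 hP hV hfloor hc hceil hcross hVc hV0 hV2 hJ hJ0 hrow hγ0 hγ1 hD hDC h1 h2 h3 h4 h5 hK
      hr13 hr23 hr34 hr35 hB13 hB23 hB34 hB35 hq1 hq2 hq3 hq4 hq5 hs1 hs2 hs3 hs4 hs5 hM21 hM22 hM23 hM24 hM25 hM41 hM42 hM43 hM44 hM45 hM61 hM62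
      hM63 hM64 hM65) hC1le hC1 hr23 hr13 hr34 hr35 (le_max_of_le_right (le_max_left _ _) : (r23)⁻¹ ≤ max (r13)⁻¹ (max (r23)⁻¹ (max (r34)⁻¹
      (r35)⁻¹))) (le_max_left _ _) (le_max_of_le_right (le_max_of_le_right (le_max_left _ _))) (le_max_of_le_right (le_max_of_le_right (le_max_right
      _ _)))
  have hu1345 := cut_to_threshold4 (fifth_cumulant_single_cut_2 hP hV hfloor hc hceil hcross hVc hV0 hV2 hJ hJ0 hrow hγ0 hγ1 hD hDC h1 h2 h3 h4 h5 hK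
      hr12 hr23 hr24 hr25 hB12 hB23 hB24 hB25 hq1 hq2 hq3 hq4 hq5 hs1 hs2 hs3 hs4 hs5 hM21 hM22 hM23 hM24 hM25 hM41 hM42 hM43 hM44 hM45 hM61 hM62
      hM63 hM64 hM65) hC1le hC1 hr12 hr23 hr24 hr25 (le_max_left _ _ : (r12)⁻¹ ≤ max (r12)⁻¹ (max (r23)⁻¹ (max (r24)⁻¹ (r25)⁻¹))) (le_max_of_le_right
      (le_max_left _ _)) (le_max_of_le_right (le_max_of_le_right (le_max_left _ _))) (le_max_of_le_right (le_max_of_le_right (le_max_right _ _)))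
  exact five_point_cut_minmax hu1 hu12 hu13 hu14 hu15 hu123 hu124 hu125 hu134 hu135 hu145 hu1234 hu1235 hu1245 hu1345

end Summit.QuantumFields.BalabanUV.T4Continuum.NE7b.SupFifthCumulantThreshold

end
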